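import Mathlib.Analysis.Matrix.HermitianFunctionalCalculus
import Mathlib.Analysis.Matrix.Order
import Mathlib.Analysis.CStarAlgebra.ContinuousFunctionalCalculus.Commute
import Mathlib.LinearAlgebra.Lagrange
import Literature.LinearAlgebra.Matrix.HermitianAeval
import Literature.LinearAlgebra.Matrix.SimultaneousDiagonalization
import HarnessLib

/-!
# Functions of a Hermitian matrix: the diagonal form from ANY unitary diagonalisation, entries,
# trace, reindexing invariance, positivity, the ordered joint diagonalisation of a commuting
# pair `B ≤ A`, and the off-diagonal bound for positive semidefinite matrices

Topic `LinearAlgebra/Matrix`, namespace `Literature.LinearAlgebra.Matrix`.  Mathlib's continuous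
functional calculus `cfc f A` of a Hermitian matrix `A` (over `𝕜 = ℝ` or `ℂ`) is defined through
ONE chosen diagonalisation (`Matrix.IsHermitian.cfc_eq`:
`cfc f A = U diag(f ∘ λ) U*` with `U = hA.eigenvectorUnitary`).  Applications (functions of
translation-invariant lattice operators diagonalised by characters; functions of commuting
pairs diagonalised jointly) need the same formula for an ARBITRARY unitary diagonalisation
`A = V diag(μ) V*`; this is the finite-dimensional spectral mapping principle
"`f(A) = V f(D) V⁻¹` does not depend on the diagonalisation" (Horn–Johnson, *Matrix Analysis*,
2nd ed., §4.1 (Theorem 4.1.5 and the remarks on polynomial functions of normal matrices);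
N. Higham, *Functions of Matrices*, §1.2, Definition 1.2 / Theorem 1.3: the value of a matrix
function is that of the Hermite/Lagrange interpolating polynomial on the spectrum), proved here by
Lagrange interpolation of `f` on the (finite) spectrum and `cfc p.eval = aeval` for polynomials.

## Contents (everything is proved; no definition and no named fact is introduced)

* `cfc_continuousOn` — every `f : ℝ → ℝ` is continuous on the (finite) real spectrum of a matrix
  (the side condition of Mathlib's `cfc` lemmas, discharged once and for all);
* `exists_polynomial_eval_eq` — Lagrange: a real function agrees with a polynomial on a finite set;
* `cfc_eq_aeval_of_eval_eq` — `cfc f A = p(A)` when `p = f` on the spectrum;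
* `isHermitian_conj_diagonal`, **`cfc_eq_conj_diagonal`** — for `V` unitary and
  `A = V diag(μ) V*`: `cfc f A = V diag(f ∘ μ) V*`;
* `conj_diagonal_apply`, **`cfc_apply_eq_sum`**, **`trace_cfc_eq_sum`**, `trace_cfc_eq_sum_eigenvalues`
  — entries `(V diag(d) V*)_{xy} = Σ_k V_{xk} d_k conj(V_{yk})` and the trace `tr f(A) = Σ_k f(μ_k)`;
* **`cfc_submatrix_equiv`**, `cfc_apply_equiv_of_invariant` — `f(A)` commutes with reindexing by a
  bijection; a symmetry of `A` (`A (σx) (σy) = A x y`) is a symmetry of `f(A)`;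
* `posSemidef_cfc_of_nonneg`, `isHermitian_cfc` — `f ≥ 0` on `[0,∞)` and `A ⪰ 0` give `f(A) ⪰ 0`;
* **`exists_joint_diagonal_le`** — commuting Hermitian `A, B` with `A - B ⪰ 0` are diagonalised by
  one unitary with ORDERED diagonals `μB_k ≤ μA_k` (the commuting case of Weyl's monotonicity
  principle, Horn–Johnson Cor. 4.3.12, via the tree's simultaneous diagonalisation
  `exists_unitaryGroup_forall_eq_conj_diagonal`); `sum_antitone_le_of_joint_diagonal` — hence
  `Σ_k g(μA_k) ≤ Σ_k g(μB_k)` for antitone `g`;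
* **`norm_apply_le_of_posSemidef`** — `‖M_{xy}‖ ≤ (re M_{xx} + re M_{yy})/2` for `M ⪰ 0`
  (the `2 × 2` principal minor test, Horn–Johnson Obs. 7.1.2 / (7.1.10)); hence
  `norm_apply_le_re_trace_of_posSemidef` (`‖M_{xy}‖ ≤ re tr M`) and
  `norm_apply_le_one_of_posSemidef_of_trace_eq_one` (density matrices have entries of norm `≤ 1`).

## References

* R. A. Horn, C. R. Johnson, *Matrix Analysis*, 2nd ed. (CUP 2013), §4.1, Cor. 4.3.12, §7.1.
  [HornJohnson2013]
* N. J. Higham, *Functions of Matrices* (SIAM 2008), §1.2. [Higham2008]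
-/

noncomputable section

open Matrix Polynomial
open scoped MatrixOrder ComplexOrder

namespace Literature.LinearAlgebra.Matrix

variable {𝕜 : Type*} [RCLike 𝕜] {n : Type*} [Fintype n] [DecidableEq n]

/-! ### Functional calculus from an arbitrary unitary diagonalisation -/

/-- Every real function is continuous on the real spectrum of a matrix (the spectrum is finite,
hence discrete).  This is the side condition of Mathlib's `cfc` algebra lemmas. [folklore] -/
theorem cfc_continuousOn (A : Matrix n n 𝕜) (f : ℝ → ℝ) : ContinuousOn f (spectrum ℝ A) := by
  rw [continuousOn_iff_continuous_restrict]; fun_prop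

/-- Lagrange interpolation: a real function agrees with a real polynomial on any finite set.
[folklore] -/
theorem exists_polynomial_eval_eq (s : Set ℝ) (hs : s.Finite) (f : ℝ → ℝ) :
    ∃ p : ℝ[X], ∀ x ∈ s, p.eval x = f x := by
  classical
  refine ⟨Lagrange.interpolate hs.toFinset id f, fun x hx => ?_⟩
  have := Lagrange.eval_interpolate_at_node (r := f) (v := id) (s := hs.toFinset)
    (Set.injOn_id _) (hs.mem_toFinset.mpr hx)
  simpa using this

/-- `cfc f A = p(A)` for any polynomial `p` that agrees with `f` on the spectrum (Higham,
Definition 1.2 / Theorem 1.3: a matrix function is the value of an interpolating polynomial).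
[cite: Higham2008, §1.2, Theorem 1.3] -/
theorem cfc_eq_aeval_of_eval_eq {A : Matrix n n 𝕜} (hA : A.IsHermitian) (f : ℝ → ℝ) (p : ℝ[X])
    (h : ∀ x ∈ spectrum ℝ A, p.eval x = f x) : cfc f A = aeval A p := by
  have hA' : IsSelfAdjoint A := hA
  rw [← cfc_polynomial p A hA']
  exact cfc_congr fun x hx => (h x hx).symm

/-- `V diag(μ) V*` is Hermitian for real `μ`. [folklore] -/
theorem isHermitian_conj_diagonal (V : Matrix n n 𝕜) (μ : n → ℝ) :
    (V * diagonal (fun k => ((μ k : ℝ) : 𝕜)) * star V).IsHermitian := by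
  have hD : (diagonal (fun k => ((μ k : ℝ) : 𝕜))).IsHermitian := by
    rw [Matrix.isHermitian_diagonal_iff]
    intro i
    exact RCLike.conj_ofReal _
  simpa [Matrix.star_eq_conjTranspose] using Matrix.isHermitian_mul_mul_conjTranspose V hD

/-- **The functional calculus from ANY unitary diagonalisation**: if `V` is unitary and
`A = V diag(μ) V*` with `μ` real, then `cfc f A = V diag(f ∘ μ) V*` for every `f : ℝ → ℝ`
("`f(A) = V f(D) V⁻¹`, independently of the diagonalisation").  Proof: interpolate `f` by a
polynomial `p` on `spectrum A ∪ range μ`; `cfc f A = p(A) = V p(diag μ) V* = V diag(p ∘ μ) V*`.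
[cite: HornJohnson2013, §4.1 (Theorem 4.1.5 and polynomial functions of normal matrices)] -/
theorem cfc_eq_conj_diagonal {A V : Matrix n n 𝕜} (hV : V ∈ Matrix.unitaryGroup n 𝕜)
    {μ : n → ℝ} (hAV : A = V * diagonal (fun k => ((μ k : ℝ) : 𝕜)) * star V) (f : ℝ → ℝ) :
    cfc f A = V * diagonal (fun k => ((f (μ k) : ℝ) : 𝕜)) * star V := by
  have hA : A.IsHermitian := hAV ▸ isHermitian_conj_diagonal V μ
  obtain ⟨p, hp⟩ := exists_polynomial_eval_eq (spectrum ℝ A ∪ Set.range μ)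
    (Matrix.finite_real_spectrum.union (Set.finite_range μ)) f
  rw [cfc_eq_aeval_of_eval_eq hA f p (fun x hx => hp x (Set.mem_union_left _ hx))]
  have hspec : A = Unitary.conjStarAlgAut ℝ (Matrix n n 𝕜) ⟨V, hV⟩
      (diagonal fun k => ((μ k : ℝ) : 𝕜)) := by
    rw [hAV]; rfl
  rw [hspec, aeval_algHom_apply, Unitary.conjStarAlgAut_apply, aeval_diagonal_ofReal]
  simp only [hp _ (Set.mem_union_right _ (Set.mem_range_self _))]

/-- Entries of a conjugated diagonal matrix: `(V diag(d) V*)_{xy} = Σ_k V_{xk} d_k conj(V_{yk})`.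
[folklore] -/
theorem conj_diagonal_apply (V : Matrix n n 𝕜) (d : n → 𝕜) (x y : n) :
    (V * diagonal d * star V) x y = ∑ k, V x k * d k * star (V y k) := by
  rw [Matrix.mul_apply]
  refine Finset.sum_congr rfl fun k _ => ?_
  rw [Matrix.mul_diagonal, Matrix.star_apply]

/-- **Entries of a matrix function**: with `A = V diag(μ) V*`, `V` unitary,
`(f(A))_{xy} = Σ_k V_{xk} f(μ_k) conj(V_{yk})`. [folklore] -/
theorem cfc_apply_eq_sum {A V : Matrix n n 𝕜} (hV : V ∈ Matrix.unitaryGroup n 𝕜)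
    {μ : n → ℝ} (hAV : A = V * diagonal (fun k => ((μ k : ℝ) : 𝕜)) * star V) (f : ℝ → ℝ)
    (x y : n) :
    cfc f A x y = ∑ k, V x k * ((f (μ k) : ℝ) : 𝕜) * star (V y k) := by
  rw [cfc_eq_conj_diagonal hV hAV f, conj_diagonal_apply]

/-- **Trace of a matrix function**: with `A = V diag(μ) V*`, `V` unitary,
`tr f(A) = Σ_k f(μ_k)`. [folklore] -/
theorem trace_cfc_eq_sum {A V : Matrix n n 𝕜} (hV : V ∈ Matrix.unitaryGroup n 𝕜)
    {μ : n → ℝ} (hAV : A = V * diagonal (fun k => ((μ k : ℝ) : 𝕜)) * star V) (f : ℝ → ℝ) :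
    trace (cfc f A) = ((∑ k, f (μ k) : ℝ) : 𝕜) := by
  rw [cfc_eq_conj_diagonal hV hAV f, trace_unitary_conj hV, trace_diagonal]
  push_cast
  rfl

/-- The trace of a matrix function in terms of Mathlib's eigenvalues: `tr f(A) = Σ_k f(λ_k)`.
[folklore] -/
theorem trace_cfc_eq_sum_eigenvalues {A : Matrix n n 𝕜} (hA : A.IsHermitian) (f : ℝ → ℝ) :
    trace (cfc f A) = ((∑ k, f (hA.eigenvalues k) : ℝ) : 𝕜) :=
  trace_cfc_eq_sum hA.eigenvectorUnitary.2 hA.spectral_theorem f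

/-! ### Reindexing invariance -/

/-- **Matrix functions commute with reindexing**: for a bijection `e : m ≃ n` and Hermitian `A`,
`f(A.submatrix e e) = (f(A)).submatrix e e`. [folklore] -/
theorem cfc_submatrix_equiv {m : Type*} [Fintype m] [DecidableEq m] {A : Matrix n n 𝕜}
    (hA : A.IsHermitian) (e : m ≃ n) (f : ℝ → ℝ) :
    cfc f (A.submatrix e e) = (cfc f A).submatrix e e := by
  have hAe : (A.submatrix e e).IsHermitian := hA.submatrix e
  obtain ⟨p, hp⟩ := exists_polynomial_eval_eq (spectrum ℝ A ∪ spectrum ℝ (A.submatrix e e))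
    (Matrix.finite_real_spectrum.union Matrix.finite_real_spectrum) f
  rw [cfc_eq_aeval_of_eval_eq hA f p (fun x hx => hp x (Set.mem_union_left _ hx)),
    cfc_eq_aeval_of_eval_eq hAe f p (fun x hx => hp x (Set.mem_union_right _ hx))]
  have h1 : A.submatrix e e = Matrix.reindexAlgEquiv ℝ 𝕜 e.symm A := by
    simp only [Matrix.coe_reindexAlgEquiv, Matrix.reindex_apply, Equiv.symm_symm]
  rw [h1]
  change aeval ((Matrix.reindexAlgEquiv ℝ 𝕜 e.symm : Matrix n n 𝕜 →ₐ[ℝ] Matrix m m 𝕜) A) p = _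
  rw [aeval_algHom_apply]
  change Matrix.reindexAlgEquiv ℝ 𝕜 e.symm (aeval A p) = _
  simp only [Matrix.coe_reindexAlgEquiv, Matrix.reindex_apply, Equiv.symm_symm]

/-- **A symmetry of `A` is a symmetry of `f(A)`**: if `A (σ x) (σ y) = A x y` for a bijection
`σ` (e.g. a lattice translation of a translation-invariant operator), then
`f(A) (σ x) (σ y) = f(A) x y`. [folklore] -/
theorem cfc_apply_equiv_of_invariant {A : Matrix n n 𝕜} (hA : A.IsHermitian) (σ : n ≃ n)
    (hσ : ∀ x y, A (σ x) (σ y) = A x y) (f : ℝ → ℝ) (x y : n) :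
    cfc f A (σ x) (σ y) = cfc f A x y := by
  have hsub : A.submatrix σ σ = A := by
    ext i j
    exact hσ i j
  have h := cfc_submatrix_equiv hA σ f
  rw [hsub] at h
  conv_lhs => rw [show cfc f A (σ x) (σ y) = (cfc f A).submatrix σ σ x y from rfl, ← h]

/-! ### Positivity and self-adjointness -/

/-- `f(A)` is Hermitian. [folklore] -/
theorem isHermitian_cfc (A : Matrix n n 𝕜) (f : ℝ → ℝ) : (cfc f A).IsHermitian :=
  show IsSelfAdjoint (cfc f A) from cfc_predicate f A

/-- **`f(A) ⪰ 0` for `A ⪰ 0` and `f ≥ 0` on `[0,∞)`** (spectral mapping). [folklore] -/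
theorem posSemidef_cfc_of_nonneg {A : Matrix n n 𝕜} (hA : A.PosSemidef) {f : ℝ → ℝ}
    (hf : ∀ x, 0 ≤ x → 0 ≤ f x) : (cfc f A).PosSemidef := by
  rw [← Matrix.nonneg_iff_posSemidef]
  refine cfc_nonneg fun x hx => hf x ?_
  exact spectrum_nonneg_of_nonneg (Matrix.nonneg_iff_posSemidef.mpr hA) hx

/-- `f(A) ⪰ 0` for any Hermitian `A` when `f ≥ 0` everywhere. [folklore] -/
theorem posSemidef_cfc_of_nonneg' (A : Matrix n n 𝕜) {f : ℝ → ℝ} (hf : ∀ x, 0 ≤ f x) :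
    (cfc f A).PosSemidef := by
  rw [← Matrix.nonneg_iff_posSemidef]
  exact cfc_nonneg fun x _ => hf x

/-- `f(A)` commutes with everything that commutes with `A` (Mathlib's `Commute.cfc_real`,
recorded in matrix form). [folklore] -/
theorem commute_cfc_of_commute {A B : Matrix n n 𝕜} (h : Commute A B) (f : ℝ → ℝ) :
    Commute (cfc f A) B :=
  h.cfc_real f

/-! ### Ordered joint diagonalisation of a commuting pair `B ≤ A` -/

omit [DecidableEq n] in
/-- The diagonal entries of `V* M V` at a unitary `V` are values of the quadratic form of `M`:
`(V* M V)_{kk} = (V e_k)* M (V e_k)`; in particular they have nonnegative real part when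
`M ⪰ 0`. [folklore] -/
theorem re_conj_apply_nonneg_of_posSemidef {M : Matrix n n 𝕜} (hM : M.PosSemidef)
    (V : Matrix n n 𝕜) (k : n) : 0 ≤ RCLike.re ((star V * M * V) k k) := by
  have h := hM.dotProduct_mulVec_nonneg (fun i => V i k)
  have hcalc : (star V * M * V) k k = star (fun i => V i k) ⬝ᵥ M.mulVec (fun i => V i k) := by
    simp only [Matrix.mul_apply, Matrix.star_apply, dotProduct, Matrix.mulVec, Pi.star_apply,
      Finset.sum_mul, Finset.mul_sum]
    rw [Finset.sum_comm]
    refine Finset.sum_congr rfl fun i _ => Finset.sum_congr rfl fun j _ => ?_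
    ring
  rw [hcalc]
  exact (RCLike.nonneg_iff.mp h).1

/-- **Ordered joint diagonalisation.**  Two commuting Hermitian matrices with `A - B ⪰ 0` are
diagonalised by one unitary, `A = V diag(μA) V*`, `B = V diag(μB) V*`, with `μB_k ≤ μA_k` for
every `k` — the commuting case of Weyl's monotonicity theorem.
[cite: HornJohnson2013, Cor. 4.3.12 and Thm. 4.1.6 (commuting Hermitian family)] -/
theorem exists_joint_diagonal_le {A B : Matrix n n 𝕜} (hA : A.IsHermitian) (hB : B.IsHermitian)
    (hAB : Commute A B) (hle : (A - B).PosSemidef) :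
    ∃ V ∈ Matrix.unitaryGroup n 𝕜, ∃ μA μB : n → ℝ,
      A = V * diagonal (fun k => ((μA k : ℝ) : 𝕜)) * star V ∧
      B = V * diagonal (fun k => ((μB k : ℝ) : 𝕜)) * star V ∧ ∀ k, μB k ≤ μA k := by
  obtain ⟨V, hV, d, hd⟩ := exists_unitaryGroup_forall_eq_conj_diagonal
    (fun i : Bool => if i then A else B)
    (fun i => by cases i <;> simpa)
    (fun i j => by
      cases i <;> cases j
      · exact Commute.refl _
      · exact hAB.symm
      · exact hAB
      · exact Commute.refl _)
  have hAd : A = V * diagonal (fun k => ((d true k : ℝ) : 𝕜)) * star V := by simpa using hd true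
  have hBd : B = V * diagonal (fun k => ((d false k : ℝ) : 𝕜)) * star V := by
    simpa using hd false
  refine ⟨V, hV, d true, d false, hAd, hBd, fun k => ?_⟩
  -- `(V* (A - B) V)_{kk} = μA_k - μB_k ≥ 0`
  have hdiff : star V * (A - B) * V =
      diagonal (fun k => (((d true k - d false k : ℝ) : ℝ) : 𝕜)) := by
    rw [hAd, hBd]
    have h1 : star V * V = 1 := Unitary.star_mul_self_of_mem hV
    simp only [Matrix.mul_sub, Matrix.sub_mul, ← Matrix.mul_assoc, h1, Matrix.one_mul]
    simp only [Matrix.mul_assoc, h1, Matrix.mul_one]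
    rw [diagonal_sub]
    congr 1
    funext k
    push_cast
    ring
  have hk := re_conj_apply_nonneg_of_posSemidef hle V k
  rw [hdiff, diagonal_apply_eq, RCLike.ofReal_re] at hk
  linarith

omit [DecidableEq n] in
/-- Sums of an antitone function over ordered diagonals: `Σ_k g(μA_k) ≤ Σ_k g(μB_k)` when
`μB ≤ μA` pointwise and `g` is antitone on a set containing all the values. [folklore] -/
theorem sum_antitone_le_of_le {μA μB : n → ℝ} (h : ∀ k, μB k ≤ μA k) {g : ℝ → ℝ} {s : Set ℝ}
    (hg : AntitoneOn g s) (hsA : ∀ k, μA k ∈ s) (hsB : ∀ k, μB k ∈ s) :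
    ∑ k, g (μA k) ≤ ∑ k, g (μB k) :=
  Finset.sum_le_sum fun k _ => hg (hsB k) (hsA k) (h k)

/-! ### The off-diagonal bound for positive semidefinite matrices -/

/-- The quadratic form of `M` at a two-point vector `a e_x + b e_y`. [folklore] -/
theorem star_dotProduct_mulVec_single_add_single (M : Matrix n n 𝕜) (x y : n) (a b : 𝕜) :
    star (Pi.single x a + Pi.single y b) ⬝ᵥ M *ᵥ (Pi.single x a + Pi.single y b) =
      star a * a * M x x + star a * b * M x y + star b * a * M y x + star b * b * M y y := by
  simp only [Matrix.mulVec_add, dotProduct_add, star_add, add_dotProduct, ← Pi.single_star,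
    single_dotProduct, Matrix.mulVec, dotProduct_single]
  ring

/-- The phase `c = conj(z)/‖z‖` of a non-zero scalar: `c z = ‖z‖`, `conj(c) conj(z) = ‖z‖`,
`conj(c) c = 1`. [folklore] -/
theorem phase_mul_eq_norm {z : 𝕜} (hz : z ≠ 0) :
    star z / ((‖z‖ : ℝ) : 𝕜) * z = ((‖z‖ : ℝ) : 𝕜) ∧
    star (star z / ((‖z‖ : ℝ) : 𝕜)) * star z = ((‖z‖ : ℝ) : 𝕜) ∧
    star (star z / ((‖z‖ : ℝ) : 𝕜)) * (star z / ((‖z‖ : ℝ) : 𝕜)) = 1 := by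
  have hne : ((‖z‖ : ℝ) : 𝕜) ≠ 0 := by exact_mod_cast (norm_pos_iff.mpr hz).ne'
  have h1 : star z * z = ((‖z‖ : ℝ) : 𝕜) ^ 2 := by rw [RCLike.star_def, RCLike.conj_mul]
  have h2 : z * star z = ((‖z‖ : ℝ) : 𝕜) ^ 2 := by rw [RCLike.star_def, RCLike.mul_conj]
  have hsc : star (star z / ((‖z‖ : ℝ) : 𝕜)) = z / ((‖z‖ : ℝ) : 𝕜) := by
    rw [star_div₀, star_star, RCLike.star_def, RCLike.conj_ofReal]
  refine ⟨?_, ?_, ?_⟩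
  · rw [div_mul_eq_mul_div, h1, sq, mul_div_assoc, div_self hne, mul_one]
  · rw [hsc, div_mul_eq_mul_div, h2, sq, mul_div_assoc, div_self hne, mul_one]
  · rw [hsc, div_mul_div_comm, h2, sq, div_self (mul_ne_zero hne hne)]

/-- **`‖M_{xy}‖ ≤ (re M_{xx} + re M_{yy})/2` for `M ⪰ 0`** — positivity of the quadratic form at
`e_x - c e_y` with the phase `c = conj(M_{xy})/‖M_{xy}‖` (the `2 × 2` principal minor test).
[cite: HornJohnson2013, §7.1 (Obs. 7.1.2, (7.1.10))] -/
theorem norm_apply_le_of_posSemidef {M : Matrix n n 𝕜} (hM : M.PosSemidef) (x y : n) :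
    ‖M x y‖ ≤ (RCLike.re (M x x) + RCLike.re (M y y)) / 2 := by
  have hdiag : ∀ z : n, 0 ≤ RCLike.re (M z z) := by
    intro z
    have h := hM.dotProduct_mulVec_nonneg (Pi.single z 1 + Pi.single z 0)
    rw [star_dotProduct_mulVec_single_add_single] at h
    simp only [star_one, star_zero, one_mul, mul_one, zero_mul, mul_zero, add_zero] at h
    exact (RCLike.nonneg_iff.mp h).1
  by_cases hxy : M x y = 0
  · rw [hxy, norm_zero]
    linarith [hdiag x, hdiag y]
  · obtain ⟨hc1, hc2, hc3⟩ := phase_mul_eq_norm hxy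
    set c : 𝕜 := star (M x y) / ((‖M x y‖ : ℝ) : 𝕜) with hc
    have hyx : M y x = star (M x y) := (hM.1.apply y x).symm
    have hpos := hM.dotProduct_mulVec_nonneg (Pi.single x 1 + Pi.single y (-c))
    rw [star_dotProduct_mulVec_single_add_single, hyx] at hpos
    simp only [star_one, one_mul, mul_one, star_neg, neg_mul, mul_neg, neg_neg] at hpos
    rw [hc1, hc2, hc3, one_mul] at hpos
    have hre := (RCLike.nonneg_iff.mp hpos).1
    simp only [map_add, map_neg, RCLike.ofReal_re] at hre
    linarith

/-! ### Entries of a positive semidefinite matrix are bounded by its trace -/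

/-- **`‖M_{xy}‖ ≤ re tr M` for `M ⪰ 0`**: every diagonal entry is nonnegative and hence at most the
trace, so the `2 × 2` principal-minor bound `‖M_{xy}‖ ≤ (re M_{xx} + re M_{yy})/2` gives
`‖M_{xy}‖ ≤ re tr M`. [cite: HornJohnson2013, §7.1 (Obs. 7.1.2, (7.1.10))] -/
theorem norm_apply_le_re_trace_of_posSemidef {M : Matrix n n 𝕜} (hM : M.PosSemidef) (x y : n) :
    ‖M x y‖ ≤ RCLike.re M.trace := by
  have hdiag : ∀ z : n, 0 ≤ RCLike.re (M z z) := fun z => (RCLike.nonneg_iff.mp hM.diag_nonneg).1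
  have htr : RCLike.re M.trace = ∑ z, RCLike.re (M z z) := by
    rw [Matrix.trace, map_sum]
    rfl
  have hx : RCLike.re (M x x) ≤ RCLike.re M.trace := by
    rw [htr]
    exact Finset.single_le_sum (fun z _ => hdiag z) (Finset.mem_univ x)
  have hy : RCLike.re (M y y) ≤ RCLike.re M.trace := by
    rw [htr]
    exact Finset.single_le_sum (fun z _ => hdiag z) (Finset.mem_univ y)
  have h := norm_apply_le_of_posSemidef hM x y
  linarith

/-- **Entries of a density matrix are bounded by one in norm**: `M ⪰ 0` and `tr M = 1` give
`‖M_{xy}‖ ≤ 1` (the a-priori entry bound that boxes the moment variables of a semidefinite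
relaxation over density matrices). [cite: HornJohnson2013, §7.1 (Obs. 7.1.2, (7.1.10))] -/
theorem norm_apply_le_one_of_posSemidef_of_trace_eq_one {M : Matrix n n 𝕜} (hM : M.PosSemidef)
    (htr : M.trace = 1) (x y : n) : ‖M x y‖ ≤ 1 := by
  have h := norm_apply_le_re_trace_of_posSemidef hM x y
  rwa [htr, RCLike.one_re] at h

end Literature.LinearAlgebra.Matrix

end
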